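import Mathlib
import Literature.Probability.LatticeModels.TemperleyLiebBaxterization
import Literature.Probability.LatticeModels.TemperleyLiebConnectivityBasis
import Literature.Probability.Percolation.DiagonalColumnPatterns
import Literature.Probability.Percolation.DiagonalStripTransferInhomogeneous
import Literature.Probability.Percolation.DiagonalStripTLAction
import Literature.Probability.Percolation.DiagonalStripLumping
import Literature.Probability.Percolation.DiagonalStripPlanarity
import Literature.Probability.Percolation.DiagonalStripGenericRapidities
import Literature.Probability.Percolation.DiagonalStripGenericSwap
import Literature.Probability.Percolation.DiagonalStripGenericSimplicity
import Literature.Probability.Percolation.DiagonalStripGroundStateQKZ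
import HarnessLib

/-!
# The generic ground state on the connectivity basis

Topic `Literature/Probability/Percolation`. The generic ground state `Ψ` of Ikhlef–Ponsaing's
transfer matrix (J. Stat. Phys. 149 (2012), arXiv:1202.5476, §3.4;
`DiagonalStripGenericSimplicity.lean`, `DiagonalStripGroundStateQKZ.lean`) lives on the physical
sector of valid planar lump-fixed column patterns, which `ncStateEquiv`
(`TemperleyLiebConnectivityBasis.lean`) identifies with the non-crossing states `NCState (m+1)` =
IP12's link patterns `LP_{2m+1}`. This file transports `Ψ` there (`ncVec`, via `cpOf`) and shows
that the Temperley–Lieb moves match: `cpJoin_cpOf`, `cpIsolate_cpOf` (joining/isolating patterns =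
`joinS`/`isolS` on states), `sum_fiber_cpJoin_eq`, `sum_fiber_cpIsolate_eq` (the `e_i`-fiber sums
of the kernel convention are the fiber sums of the generator maps `tlConnFun`), hence
**`ncGroundState_exchange_odd/even_upToScalar`**: on the connectivity basis the ground state
satisfies IP12's exchange equations `[q z_{i+1}/z_i]Ψ − [z_i/z_{i+1}] e_iΨ = c_i σ_iΨ` with the
Temperley–Lieb family of `isTemperleyLiebFamily_tlConn` (for which Yang–Baxter and unitarity are
proved), up to the scalars `c_i`; in operator form (`tlConn_apply`, `tlRnum_tlConn_apply`,
`tlConnFun_two_mul`, `tlConnFun_two_mul_add_one`): **`ncGroundState_tlRnum_odd/even_upToScalar`** —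
`(tlRnum q (z_i/z_{i+1}) (tlConn k)) Ψ = c_i · σ_i Ψ` componentwise, with the `Ř`-numerator
`tlRnum q w e = [q/w] - [w] e` of `TemperleyLiebBaxterization.lean`.

## References

* Y. Ikhlef, A. K. Ponsaing, J. Stat. Phys. 149 (2012) 10–36, arXiv:1202.5476, §3.1, §3.4.
  [IkhlefPonsaing2012]
-/

namespace Literature.Probability.Percolation

open Literature.Probability.LatticeModels

variable {m : ℕ}

/-! ### Transport of the ground state to the connectivity basis -/

section NCTransport

open Literature.Probability.LatticeModels.TemperleyLieb

/-- The column pattern of a non-crossing state (the inverse dictionary `ncStateEquiv.symm`, as a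
bare pattern: flags = the class of the bottom site). [cite: IkhlefPonsaing2012, §3.1] -/
def cpOf (s : NCState (m + 1)) : ColPattern m := (s.1, fun i => s.1 0 i)

/-- `cpOf` is the inverse dictionary. [folklore] -/
theorem cpOf_eq (s : NCState (m + 1)) : cpOf s = ((ncStateEquiv m).symm s).1 := rfl

/-- `cpOf` lands in the physical sector. [folklore] -/
theorem cpOf_mem (s : NCState (m + 1)) : IsValid 0 (cpOf s) ∧ IsPlanar (cpOf s) ∧ lump (cpOf s) = cpOf s :=
  ((ncStateEquiv m).symm s).2

/-- `cpOf` is injective. [folklore] -/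
theorem cpOf_injective : Function.Injective (cpOf (m := m)) := fun s t h => by
  have : (ncStateEquiv m).symm s = (ncStateEquiv m).symm t := Subtype.ext h
  exact (ncStateEquiv m).symm.injective this

/-- Every pattern of the physical sector is a `cpOf`. [folklore] -/
theorem exists_cpOf_eq {Q : ColPattern m} (hQ : IsValid 0 Q ∧ IsPlanar Q ∧ lump Q = Q) : ∃ s, cpOf s = Q :=
  ⟨ncStateEquiv m ⟨Q, hQ⟩, congrArg Subtype.val ((ncStateEquiv m).left_inv ⟨Q, hQ⟩)⟩

/-- **Joining on patterns is joining on states.** [cite: IkhlefPonsaing2012, §3.1] -/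
theorem cpJoin_cpOf (a b : Fin (m + 1)) (hab : (b : ℕ) = a + 1) (s : NCState (m + 1)) :
    cpJoin a b (cpOf s) = cpOf (NCState.joinS a b hab s) := by
  refine Prod.ext rfl (funext fun i => ?_)
  -- flags: `s 0 i ∨ (s i a ∧ s 0 b) ∨ (s i b ∧ s 0 a)` vs `s 0 i ∨ (s 0 a ∧ s b i) ∨ (s 0 b ∧ s a i)`
  show ((s.1 0 i || (s.1 i a && s.1 0 b) || (s.1 i b && s.1 0 a)) : Bool) =
    (s.1 0 i || (s.1 0 a && s.1 b i) || (s.1 0 b && s.1 a i))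
  have hs : ∀ x y, s.1 x y = s.1 y x := fun x y => by
    rcases hx : s.1 x y with _ | _ <;> rcases hy : s.1 y x with _ | _
    · rfl
    · exact absurd (s.2.symm _ _ hy) (by rw [hx]; decide)
    · exact absurd (s.2.symm _ _ hx) (by rw [hy]; decide)
    · rfl
  rw [hs i a, hs i b]
  cases s.1 0 i <;> cases s.1 a i <;> cases s.1 0 b <;> cases s.1 b i <;> cases s.1 0 a <;> rfl

/-- **Isolating on patterns is isolating on states** (a site other than the wall site).
[cite: IkhlefPonsaing2012, §3.1] -/
theorem cpIsolate_cpOf {a : Fin (m + 1)} (ha : a ≠ 0) (s : NCState (m + 1)) :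
    cpIsolate a (cpOf s) = cpOf (NCState.isolS a s) := by
  refine Prod.ext rfl (funext fun i => ?_)
  show (!decide (i = a) && s.1 0 i) = (decide ((0 : Fin (m + 1)) = i) || (!decide ((0 : Fin (m + 1)) = a) && !decide (i = a) && s.1 0 i))
  by_cases hi : i = a
  · subst hi
    simp [ha.symm]
  · by_cases h0 : (0 : Fin (m + 1)) = i
    · subst h0
      simp [hi, s.2.refl 0]
    · simp [hi, h0, ha.symm]

/-- **Fiber sums transport**: for a vector supported on the physical sector, the sum over the
`e`-fiber of `cpOf s` (up to lumping) is the sum over the fiber of `s` under the state map.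
[folklore] -/
theorem sum_fiber_cpOf {K : Type*} [AddCommMonoid K] {ψ : ColPattern m → K}
    (hsupp : ∀ Q, ψ Q ≠ 0 → IsValid 0 Q ∧ IsPlanar Q ∧ lump Q = Q)
    {g : ColPattern m → ColPattern m} {G : NCState (m + 1) → NCState (m + 1)}
    (hgG : ∀ s, lump (g (cpOf s)) = cpOf (G s)) (s : NCState (m + 1)) :
    ∑ Q₀ ∈ Finset.univ.filter (fun Q₀ => lump (g Q₀) = cpOf s), ψ Q₀ =
      ∑ s₀ ∈ Finset.univ.filter (fun s₀ => G s₀ = s), ψ (cpOf s₀) := by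
  classical
  -- restrict the left sum to the image of `cpOf`
  rw [← Finset.sum_filter_add_sum_filter_not (Finset.univ.filter fun Q₀ => lump (g Q₀) = cpOf s)
    (fun Q₀ => ∃ s₀, cpOf s₀ = Q₀)]
  have hzero : ∑ Q₀ ∈ (Finset.univ.filter fun Q₀ => lump (g Q₀) = cpOf s).filter (fun Q₀ => ¬ ∃ s₀, cpOf s₀ = Q₀), ψ Q₀ = 0 := by
    refine Finset.sum_eq_zero fun Q₀ hQ₀ => ?_
    by_contra h
    exact (Finset.mem_filter.1 hQ₀).2 (exists_cpOf_eq (hsupp Q₀ h))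
  rw [hzero, add_zero]
  -- reindex by `s₀`
  symm
  refine Finset.sum_nbij' (fun s₀ => cpOf s₀) (fun Q₀ => if h : ∃ s₀, cpOf s₀ = Q₀ then h.choose else s) ?_ ?_ ?_ ?_ ?_
  · intro s₀ hs₀
    have hG : G s₀ = s := (Finset.mem_filter.1 hs₀).2
    simp only [Finset.mem_filter, Finset.mem_univ, true_and]
    exact ⟨by rw [hgG, hG], ⟨s₀, rfl⟩⟩
  · intro Q₀ hQ₀
    simp only [Finset.mem_filter, Finset.mem_univ, true_and] at hQ₀ ⊢
    obtain ⟨⟨hQ, hex⟩⟩ := And.intro hQ₀ trivial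
    rw [dif_pos hex]
    apply cpOf_injective
    rw [← hgG, hex.choose_spec, hQ]
  · intro s₀ _
    have hex : ∃ s₁, cpOf s₁ = cpOf s₀ := ⟨s₀, rfl⟩
    simp only [dif_pos hex]
    exact cpOf_injective hex.choose_spec
  · intro Q₀ hQ₀
    simp only [Finset.mem_filter, Finset.mem_univ, true_and] at hQ₀
    simp only [dif_pos hQ₀.2]
    exact hQ₀.2.choose_spec
  · intro s₀ _
    rfl

/-- The ground state on the connectivity basis. [cite: IkhlefPonsaing2012, §3.4] -/
def ncVec {K : Type*} (ψ : ColPattern m → K) : NCState (m + 1) → K := fun s => ψ (cpOf s)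

/-- **The odd exchange equation on the connectivity basis**: for `ψ` supported on the physical
sector, the `e_{2j+1}`-fiber sum is the fiber sum of `joinS j (j+1)`. [cite: IkhlefPonsaing2012, §3.4] -/
theorem sum_fiber_cpJoin_eq {K : Type*} [AddCommMonoid K] {ψ : ColPattern m → K}
    (hsupp : ∀ Q, ψ Q ≠ 0 → IsValid 0 Q ∧ IsPlanar Q ∧ lump Q = Q)
    (j j1 : Fin (m + 1)) (hj1 : (j1 : ℕ) = j + 1) (s : NCState (m + 1)) :
    ∑ Q₀ ∈ Finset.univ.filter (fun Q₀ => lump (cpJoin j j1 Q₀) = cpOf s), ψ Q₀ =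
      ∑ s₀ ∈ Finset.univ.filter (fun s₀ => NCState.joinS j j1 hj1 s₀ = s), ncVec ψ s₀ :=
  sum_fiber_cpOf hsupp (fun s₀ => by rw [cpJoin_cpOf j j1 hj1, (cpOf_mem _).2.2]) s

/-- **The even exchange equation on the connectivity basis**: the `e_{2b}`-fiber sum is the fiber
sum of `isolS b` (`b ≠ 0`). [cite: IkhlefPonsaing2012, §3.4] -/
theorem sum_fiber_cpIsolate_eq {K : Type*} [AddCommMonoid K] {ψ : ColPattern m → K}
    (hsupp : ∀ Q, ψ Q ≠ 0 → IsValid 0 Q ∧ IsPlanar Q ∧ lump Q = Q)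
    {b : Fin (m + 1)} (hb : b ≠ 0) (s : NCState (m + 1)) :
    ∑ Q₀ ∈ Finset.univ.filter (fun Q₀ => lump (cpIsolate b Q₀) = cpOf s), ψ Q₀ =
      ∑ s₀ ∈ Finset.univ.filter (fun s₀ => NCState.isolS b s₀ = s), ncVec ψ s₀ :=
  sum_fiber_cpOf hsupp (fun s₀ => by rw [cpIsolate_cpOf hb, (cpOf_mem _).2.2]) s

/-- **The generic ground state on the connectivity basis satisfies IP12's exchange equations up to
scalars** (odd levels, `e_{2j+1} = join`). [cite: IkhlefPonsaing2012, §3.4] -/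
theorem ncGroundState_exchange_odd_upToScalar {q : ℂ} (hq : q ^ 2 + q + 1 = 0)
    {ψ : ColPattern m → RapidityField ℂ}
    (hψ : ∀ Q', ∑ Q, ipTransferMatrixW m (genC ℂ q) (genW ℂ) (genZ ℂ) Q Q' * ψ Q = ψ Q') (hψ0 : ψ ≠ 0)
    (j j1 : Fin (m + 1)) (hj1 : (j1 : ℕ) = j + 1) :
    ∃ c : RapidityField ℂ, ∀ s : NCState (m + 1),
      qbr (genC ℂ q * genZ ℂ (2 * j + 2) / genZ ℂ (2 * j + 1)) * ncVec ψ s -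
          qbr (genZ ℂ (2 * j + 1) / genZ ℂ (2 * j + 2)) *
            ∑ s₀ ∈ Finset.univ.filter (fun s₀ => NCState.joinS j j1 hj1 s₀ = s), ncVec ψ s₀ =
        c * genSwap ℂ (2 * j + 1) (ncVec ψ s) := by
  obtain ⟨c, hc⟩ := groundState_exchange_odd_upToScalar hq hψ hψ0 j j1 hj1
  refine ⟨c, fun s => ?_⟩
  rw [← sum_fiber_cpJoin_eq (fun Q h => groundState_support hq hψ h) j j1 hj1 s]
  exact hc (cpOf s)

/-- The same at even levels (`e_{2b} = isolate b`, `b ≠ 0`). [cite: IkhlefPonsaing2012, §3.4] -/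
theorem ncGroundState_exchange_even_upToScalar {q : ℂ} (hq : q ^ 2 + q + 1 = 0)
    {ψ : ColPattern m → RapidityField ℂ}
    (hψ : ∀ Q', ∑ Q, ipTransferMatrixW m (genC ℂ q) (genW ℂ) (genZ ℂ) Q Q' * ψ Q = ψ Q') (hψ0 : ψ ≠ 0)
    (b0 b : Fin (m + 1)) (hb0 : (b : ℕ) = b0 + 1) :
    ∃ c : RapidityField ℂ, ∀ s : NCState (m + 1),
      qbr (genC ℂ q * genZ ℂ (2 * b + 1) / genZ ℂ (2 * b)) * ncVec ψ s -
          qbr (genZ ℂ (2 * b) / genZ ℂ (2 * b + 1)) *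
            ∑ s₀ ∈ Finset.univ.filter (fun s₀ => NCState.isolS b s₀ = s), ncVec ψ s₀ =
        c * genSwap ℂ (2 * b) (ncVec ψ s) := by
  obtain ⟨c, hc⟩ := groundState_exchange_even_upToScalar hq hψ hψ0 b0 b hb0
  have hb : b ≠ 0 := by
    intro h; rw [h] at hb0; simp at hb0
  refine ⟨c, fun s => ?_⟩
  rw [← sum_fiber_cpIsolate_eq (fun Q h => groundState_support hq hψ h) hb s]
  exact hc (cpOf s)

/-- **The ground state is nonzero on the connectivity basis.** [folklore] -/
theorem ncVec_ne_zero {q : ℂ} (hq : q ^ 2 + q + 1 = 0) {ψ : ColPattern m → RapidityField ℂ}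
    (hψ : ∀ Q', ∑ Q, ipTransferMatrixW m (genC ℂ q) (genW ℂ) (genZ ℂ) Q Q' * ψ Q = ψ Q') (hψ0 : ψ ≠ 0) :
    ncVec ψ ≠ 0 := by
  intro h
  apply hψ0
  funext Q
  by_contra hQ
  obtain ⟨s, rfl⟩ := exists_cpOf_eq (groundState_support hq hψ hQ)
  exact hQ (congrFun h s)

end NCTransport

/-! ### Operator form on the connectivity basis: `Ř`-numerators and the generators `tlConn` -/

section OperatorForm

open Literature.Probability.LatticeModels.TemperleyLieb

variable {K : Type*} [Field K]

/-- A vector on the states as a finitely supported function. [folklore] -/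
noncomputable def ncFinsupp (v : NCState (m + 1) → K) : NCState (m + 1) →₀ K :=
  Finsupp.equivFunOnFinite.symm v

/-- Components of `ncFinsupp`. [folklore] -/
@[simp] theorem ncFinsupp_apply (v : NCState (m + 1) → K) (s : NCState (m + 1)) : ncFinsupp v s = v s := rfl

/-- **The generators act by fiber sums**: `(e_k v)(s) = Σ_{e_k s₀ = s} v(s₀)`. [folklore] -/
theorem tlConn_apply (k : Fin (2 * m)) (v : NCState (m + 1) →₀ K) (s : NCState (m + 1)) :
    (tlConn m K k v) s = ∑ s₀ ∈ Finset.univ.filter (fun s₀ => tlConnFun m k s₀ = s), v s₀ := by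
  classical
  rw [tlConn, Finsupp.lmapDomain_apply, Finsupp.mapDomain, Finsupp.sum_apply,
    Finsupp.sum_fintype _ _ (fun _ => by simp)]
  simp only [Finsupp.single_apply]
  rw [Finset.sum_filter]

/-- The `Ř`-numerator acts componentwise as `[q/w] v(s) - [w] (e v)(s)`. [folklore] -/
theorem tlRnum_tlConn_apply (q w : K) (k : Fin (2 * m)) (v : NCState (m + 1) →₀ K) (s : NCState (m + 1)) :
    (tlRnum q w (tlConn m K k) v) s =
      qbr (q / w) * v s - qbr w * ∑ s₀ ∈ Finset.univ.filter (fun s₀ => tlConnFun m k s₀ = s), v s₀ := by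
  rw [tlRnum, LinearMap.sub_apply, LinearMap.smul_apply, Module.algebraMap_end_apply, Finsupp.sub_apply,
    Finsupp.smul_apply, Finsupp.smul_apply, tlConn_apply, smul_eq_mul, smul_eq_mul]

/-- The even generator `k = 2j'` is the join of `j', j'+1`. [folklore] -/
theorem tlConnFun_two_mul (j' : Fin m) :
    tlConnFun m ⟨2 * j', by omega⟩ = NCState.joinS (Fin.castSucc j') j'.succ (by simp) := by
  have hh : halfIdx m ⟨2 * j', by omega⟩ = j' := Fin.ext (by simp [halfIdx])
  funext s
  apply Subtype.ext
  rw [tlConnFun_of_even m (by simp)]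
  simp only [NCState.joinS_val, hh]

/-- The odd generator `k = 2b₀+1` isolates `b₀+1`. [folklore] -/
theorem tlConnFun_two_mul_add_one (b0 : Fin m) :
    tlConnFun m ⟨2 * b0 + 1, by omega⟩ = NCState.isolS b0.succ := by
  have hh : halfIdx m ⟨2 * b0 + 1, by omega⟩ = b0 := Fin.ext (by simp [halfIdx]; omega)
  funext s
  apply Subtype.ext
  rw [tlConnFun_of_odd m (by simp)]
  simp only [NCState.isolS_val, hh]

/-- **IP12's exchange equations in operator form on the connectivity basis, up to scalars** (odd
level `i = 2j'+1`, generator `e_i ↔ tlConn (2j')`): for the generic ground state `Ψ`,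
`(Ř-numerator)(z_i/z_{i+1}) Ψ = c_i · σ_i Ψ` componentwise, where the `Ř`-numerator is
`tlRnum q w e = [q/w] - [w] e` of `TemperleyLiebBaxterization.lean`. [cite: IkhlefPonsaing2012, §3.4] -/
theorem ncGroundState_tlRnum_odd_upToScalar {q : ℂ} (hq : q ^ 2 + q + 1 = 0)
    {ψ : ColPattern m → RapidityField ℂ}
    (hψ : ∀ Q', ∑ Q, ipTransferMatrixW m (genC ℂ q) (genW ℂ) (genZ ℂ) Q Q' * ψ Q = ψ Q') (hψ0 : ψ ≠ 0)
    (j' : Fin m) :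
    ∃ c : RapidityField ℂ, ∀ s : NCState (m + 1),
      (tlRnum (genC ℂ q) (genZ ℂ (2 * j' + 1) / genZ ℂ (2 * j' + 2))
          (tlConn m (RapidityField ℂ) ⟨2 * j', by omega⟩) (ncFinsupp (ncVec ψ))) s =
        c * genSwap ℂ (2 * j' + 1) (ncVec ψ s) := by
  obtain ⟨c, hc⟩ := ncGroundState_exchange_odd_upToScalar hq hψ hψ0 (Fin.castSucc j') j'.succ (by simp)
  refine ⟨c, fun s => ?_⟩
  rw [tlRnum_tlConn_apply, tlConnFun_two_mul, div_div_eq_mul_div]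
  simp only [ncFinsupp_apply, Fin.val_castSucc] at hc ⊢
  exact hc s

/-- The same at an even level `i = 2b₀+2` (generator `e_i ↔ tlConn (2b₀+1)`). [cite: IkhlefPonsaing2012, §3.4] -/
theorem ncGroundState_tlRnum_even_upToScalar {q : ℂ} (hq : q ^ 2 + q + 1 = 0)
    {ψ : ColPattern m → RapidityField ℂ}
    (hψ : ∀ Q', ∑ Q, ipTransferMatrixW m (genC ℂ q) (genW ℂ) (genZ ℂ) Q Q' * ψ Q = ψ Q') (hψ0 : ψ ≠ 0)
    (b0 : Fin m) :
    ∃ c : RapidityField ℂ, ∀ s : NCState (m + 1),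
      (tlRnum (genC ℂ q) (genZ ℂ (2 * b0 + 2) / genZ ℂ (2 * b0 + 3))
          (tlConn m (RapidityField ℂ) ⟨2 * b0 + 1, by omega⟩) (ncFinsupp (ncVec ψ))) s =
        c * genSwap ℂ (2 * b0 + 2) (ncVec ψ s) := by
  obtain ⟨c, hc⟩ := ncGroundState_exchange_even_upToScalar hq hψ hψ0 (Fin.castSucc b0) b0.succ (by simp)
  refine ⟨c, fun s => ?_⟩
  rw [tlRnum_tlConn_apply, tlConnFun_two_mul_add_one, div_div_eq_mul_div]
  simp only [ncFinsupp_apply, Fin.val_succ] at hc ⊢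
  have e1 : 2 * ((b0 : ℕ) + 1) = 2 * b0 + 2 := by ring
  have e2 : 2 * (b0 : ℕ) + 2 + 1 = 2 * b0 + 3 := by ring
  rw [e1] at hc
  rw [e2] at hc
  exact hc s

end OperatorForm

end Literature.Probability.Percolation
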